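import Summits.QuantumFields.BalabanUV.T4Continuum.Support.ShellMeasurePinnedNorm

/-!
# `T4Continuum.ShellMeasurePinnedProp4` — PINNED `Prop4Hyp` FROM A LOCATED QUADRATIC MAJORANT; BLOCK-SUPPORTED
# FIELDS HAVE FLAT PINNED SIZE (owner row S75; the bridge of the locality road left OPEN at S70 3∕3, journal l.16737)
(cell `pub-balaban`, sub-cell `t4`, spine estimate NE7c (node U5b); owner lineage `b2b-balaban-t4-ne7c-p1`, gen 31,
row S75 of `t4/b2b-balaban-t4-ne7c-p1/LEAVES-NE7c-P1.md`; ADDITIVE — imports S69 `ShellMeasurePinnedNorm` (p223286: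
`pinW`, `norm_apply_le_exp_neg`, `norm_toPiL_le_of_nonneg`; hence S65 f2a `ShellMeasureMultiGridNorms.WSup` with
`toPiL`, `norm_le_iff`, `differentiableOn_iff`, and the Literature scheme file `B11Prop6Scheme` with `Prop4Hyp`) ONLY;
[folklore]; 0 `def`, 0 `def … : Prop`, 0 sorry, 0 citations)

HONEST FRAMING.  Finite four-torus programme, rung (B)+1 only — NOT infinite volume, NOT a mass gap, NOT the Clay
problem, NOT summit progress; (B), `BetaPertHyp`, (B^μ) not consumed.  NE7c (`T4IndicatorShell.ShellWeightBound`) is NOT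
PRINTED in [Balaban 1983–89] and NOT PROVED; «NE7c ⇐ the named binders» (trigger c3).  Nothing printed is asserted;
no estimate of Bałaban's is discharged; this file is functional-analytic PLUMBING on finite index sets.

THE POINT.  The locality road (owner finding F-ne7cp1-g30-1; S69 → S70 → S71) re-reads END-II's exponent-field chain
in the PINNED spaces `WSup (pinW δ′ ϖ) 1 𝔄` of S69.  Row S70 (leaf-01-g6, `ShellMeasureLandauPinnedEnd.
slotAC_realized_su2_landauChart_pinned`, p224390) and its companions (leaf-07-g6 `ShellMeasureLandauPinnedFixedPoint`∕
`…PinnedField`, leaf-08-g12 `ShellMeasureLandauDerivativeDecayPinned`) keep the scheme's NONLINEAR binder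
`hW : Prop4Hyp (W𝒱 V) C₄ a₃` ([Balaban1985Variational] Prop. 4 (97)–(98) TYPE: `‖W Y‖ ≤ C₄‖Y‖²` + analyticity on the
ball) AS A BINDER IN THE PINNED CURRENCY, and leaf-01-g6 recorded the missing bridge (l.16737): «decaying DERIVATIVE
kernel ⇒ pinned `Prop4Hyp` ∕ pinned quadratic bound … plus `Φ` block-supported ⇒ pinned size = flat size».  This file is
that bridge, from DISPLAYED flat data of printed TYPE:
* §1 `norm_ofPin_le_exp_of_support` ∕ `norm_ofPin_le_of_support`: a flat field VANISHING off a set of pin depth `≤ ϖ₀`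
  has pinned norm `≤ e^{δ′ϖ₀}·‖·‖_flat`; at depth `0` (the block itself) the pinned size IS the flat size — the `hΦp`
  input of `ShellMeasureLandauPinnedField` for the block-supported coarse field `Φ V (cplx y)` ((75)∕(44) TYPE bound `b`).
* §2 `pinned_component_le`, **`pinned_quad_le`**: a flat nonlinear map `W : (Λ → 𝔄) → (Λ′ → 𝔅)` with a LOCATED
  QUADRATIC MAJORANT `‖W A c‖ ≤ ‖A‖·Σ_b k c b·‖A b‖` on the flat ball `‖A‖ < a₃` (`k ≥ 0`; for `(δ∕δA′)V` of a LOCAL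
  action, `k c b = C·[b, c share a plaquette]`; for (73)-type objects a decaying kernel) whose CONJUGATED row sums obey
  `Σ_b k c b·e^{δ′ρ(c,b)} ≤ M`, read between the pinned spaces with a ONE-SIDED LIPSCHITZ pin (`ϖ x ≤ ϖ y + ρ x y`,
  `δ′ ≥ 0`, `ϖ ≥ 0`), satisfies `‖W Y‖_pin ≤ M·‖Y‖_pin²` on `‖Y‖_pin < a₃` — the pinned ball lies in the flat ball
  (`‖·‖_flat ≤ ‖·‖_pin`, S69) and `e^{δ′ϖ c}·‖A b‖ ≤ e^{δ′ρ(c,b)}·(e^{δ′ϖ b}‖A b‖) ≤ e^{δ′ρ(c,b)}·‖Y‖_pin`.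
* §3 **`prop4Hyp_pinned`**: §2 + the analyticity clause transferred through S65 f2a's `WSup.differentiableOn_iff`
  ⟹ `B11Prop6Scheme.Prop4Hyp W_pin M a₃` LITERALLY, `W_pin := (toPiL pin′).symm ∘ W ∘ toPiL pin` — S70 f4's `hW` in
  the pinned currency; §4 a non-vacuity toy (`W = 0`).
LOCATED INPUTS (displayed, NOT discharged, NOT asserted): the majorant kernel `k` and its conjugated row sums ((98)
TYPE in located form; [Balaban1985Variational] (73) TYPE when `W` is a derivative object), flat analyticity on the ball.
NOTHING in the countdown moves; NE7c NOT PROVED; spine PROVED 0∕9.  HONEST DEPENDENCY (cell): continuum YM on T⁴ ⇐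
BetaPertH ∧ nine spine estimates (0/9 proved); BetaPertH ⇐ (D1) ∧ (D4) ∧ CAP+tail; G-an2-4 gates asym, D1 and NE2/3/4.
-/

noncomputable section

open Metric Set Function

namespace Summit.QuantumFields.BalabanUV.T4Continuum.ShellMeasurePinnedProp4

open Literature.MathematicalPhysics.QuantumFieldTheory.Balaban1983to89
open B11Prop6Scheme (Prop4Hyp)
open Summit.QuantumFields.BalabanUV.T4Continuum.ShellMeasureMultiGridNorms (WSup)
open Summit.QuantumFields.BalabanUV.T4Continuum.ShellMeasurePinnedNorm
  (pinW pinW_apply pinW_pos norm_apply_le_exp_neg norm_toPiL_le_of_nonneg)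

variable {Λ Λ' : Type*} [Fintype Λ] [Fintype Λ'] {𝔄 𝔅 : Type*} [NormedAddCommGroup 𝔄] [NormedSpace ℂ 𝔄]
  [NormedAddCommGroup 𝔅] [NormedSpace ℂ 𝔅]

/-! ## §1 Block-supported fields: pinned size versus flat size -/

section Support

omit [Fintype Λ'] in
/-- **A FLAT FIELD SUPPORTED AT PIN DEPTH `≤ ϖ₀` HAS PINNED NORM `≤ e^{δ′ϖ₀}·‖·‖_flat`** (`δ′ ≥ 0`): if `A b = 0`
whenever `ϖ₀ < ϖ b`, then `‖(toPiL pin).symm A‖ ≤ e^{δ′ϖ₀}·‖A‖`. [folklore] -/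
theorem norm_ofPin_le_exp_of_support {δ' ϖ₀ : ℝ} (hδ' : 0 ≤ δ') (ϖ : Λ → ℝ) (A : Λ → 𝔄)
    (hsupp : ∀ b, ϖ₀ < ϖ b → A b = 0) :
    ‖((WSup.toPiL (pinW δ' ϖ) 1).symm A : WSup (pinW δ' ϖ) 1 𝔄)‖ ≤ Real.exp (δ' * ϖ₀) * ‖A‖ := by
  refine (WSup.norm_le_iff (pinW δ' ϖ) 1 (by positivity)).2 fun b => ?_
  rw [pow_one, pinW_apply, WSup.toPiL_symm_apply]
  by_cases hb : ϖ₀ < ϖ b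
  · rw [hsupp b hb, norm_zero, mul_zero]; positivity
  · exact mul_le_mul (Real.exp_le_exp.2 (mul_le_mul_of_nonneg_left (not_lt.1 hb) hδ')) (norm_le_pi_norm A b)
      (norm_nonneg _) (by positivity)

omit [Fintype Λ'] in
/-- **AT DEPTH `0` THE PINNED SIZE IS THE FLAT SIZE**: a flat field vanishing off the block `{ϖ ≤ 0}` (pin profile
`ϖ ≥ 0` = distance to the block) has `‖(toPiL pin).symm A‖ ≤ ‖A‖` — S70 (i), the `hΦp` of
`ShellMeasureLandauPinnedField` for the block-supported coarse field. [folklore] -/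
theorem norm_ofPin_le_of_support {δ' : ℝ} (hδ' : 0 ≤ δ') (ϖ : Λ → ℝ) (A : Λ → 𝔄)
    (hsupp : ∀ b, 0 < ϖ b → A b = 0) :
    ‖((WSup.toPiL (pinW δ' ϖ) 1).symm A : WSup (pinW δ' ϖ) 1 𝔄)‖ ≤ ‖A‖ := by
  simpa using norm_ofPin_le_exp_of_support (ϖ₀ := 0) hδ' ϖ A hsupp

end Support

/-! ## §2 The pinned quadratic bound from a located quadratic majorant -/

section Quad

variable {S : Type*}

omit [Fintype Λ'] in
/-- **ONE CONJUGATED COMPONENT**: with the one-sided Lipschitz pin `ϖ x ≤ ϖ y + ρ x y` and `δ′ ≥ 0`,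
`e^{δ′ϖ(c)}·‖A b‖ ≤ e^{δ′ρ(c, pos b)}·‖Y‖_pin` for the pinned field `Y` with flat components `A = toPiL Y`. [folklore] -/
theorem pinned_component_le (ρ : S → S → ℝ) (posIn : Λ → S) (ϖ : S → ℝ) {δ' : ℝ} (hδ' : 0 ≤ δ')
    (hϖ : ∀ x y, ϖ x ≤ ϖ y + ρ x y) (Y : WSup (pinW δ' (ϖ ∘ posIn)) 1 𝔄) (c : S) (b : Λ) :
    Real.exp (δ' * ϖ c) * ‖Y b‖ ≤ Real.exp (δ' * ρ c (posIn b)) * ‖Y‖ := by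
  have h1 := norm_apply_le_exp_neg δ' (ϖ ∘ posIn) Y b
  simp only [comp_apply] at h1
  have h2 : Real.exp (δ' * ϖ c) * Real.exp (-(δ' * ϖ (posIn b))) ≤ Real.exp (δ' * ρ c (posIn b)) := by
    rw [← Real.exp_add]
    exact Real.exp_le_exp.2 (by nlinarith [hϖ c (posIn b)])
  calc Real.exp (δ' * ϖ c) * ‖Y b‖
      ≤ Real.exp (δ' * ϖ c) * (Real.exp (-(δ' * ϖ (posIn b))) * ‖Y‖) :=
        mul_le_mul_of_nonneg_left h1 (by positivity)
    _ = (Real.exp (δ' * ϖ c) * Real.exp (-(δ' * ϖ (posIn b)))) * ‖Y‖ := by ring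
    _ ≤ Real.exp (δ' * ρ c (posIn b)) * ‖Y‖ := mul_le_mul_of_nonneg_right h2 (norm_nonneg _)

/-- **THE PINNED QUADRATIC BOUND.**  A flat nonlinear map `W` with a LOCATED QUADRATIC MAJORANT
`‖W A c‖ ≤ ‖A‖·Σ_b k c b·‖A b‖` on the flat ball `‖A‖ < a₃` (`k ≥ 0`) and conjugated row sums
`Σ_b k c b·e^{δ′ρ(pos′ c, pos b)} ≤ M` (`M ≥ 0`), read between the pinned spaces (one-sided Lipschitz pin, `δ′ ≥ 0`,
`ϖ ≥ 0`), satisfies `‖W_pin Y‖ ≤ M·‖Y‖²` whenever `‖Y‖_pin < a₃`. [folklore] -/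
theorem pinned_quad_le (W : (Λ → 𝔄) → (Λ' → 𝔅)) (k : Λ' → Λ → ℝ) (ρ : S → S → ℝ) (posIn : Λ → S)
    (posOut : Λ' → S) (ϖ : S → ℝ) {δ' a₃ M : ℝ} (hδ' : 0 ≤ δ') (hϖ0 : ∀ x, 0 ≤ ϖ x)
    (hϖ : ∀ x y, ϖ x ≤ ϖ y + ρ x y) (hk : ∀ c b, 0 ≤ k c b)
    (hquad : ∀ A : Λ → 𝔄, ‖A‖ < a₃ → ∀ c, ‖W A c‖ ≤ ‖A‖ * ∑ b, k c b * ‖A b‖)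
    (hM0 : 0 ≤ M) (hM : ∀ c, ∑ b, k c b * Real.exp (δ' * ρ (posOut c) (posIn b)) ≤ M)
    (Y : WSup (pinW δ' (ϖ ∘ posIn)) 1 𝔄) (hY : ‖Y‖ < a₃) :
    ‖((WSup.toPiL (pinW δ' (ϖ ∘ posOut)) 1).symm (W (WSup.toPiL (pinW δ' (ϖ ∘ posIn)) 1 Y)) :
        WSup (pinW δ' (ϖ ∘ posOut)) 1 𝔅)‖ ≤ M * ‖Y‖ ^ 2 := by
  set A : Λ → 𝔄 := WSup.toPiL (pinW δ' (ϖ ∘ posIn)) 1 Y with hA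
  have hflat : ‖A‖ ≤ ‖Y‖ := norm_toPiL_le_of_nonneg hδ' (fun b => hϖ0 (posIn b)) Y
  have hAa : ‖A‖ < a₃ := hflat.trans_lt hY
  have hY0 : 0 ≤ ‖Y‖ := norm_nonneg _
  refine (WSup.norm_le_iff (pinW δ' (ϖ ∘ posOut)) 1 (by positivity)).2 fun c => ?_
  rw [pow_one, pinW_apply, WSup.toPiL_symm_apply, comp_apply]
  -- the conjugated majorant
  have h1 : Real.exp (δ' * ϖ (posOut c)) * ‖W A c‖ ≤
      ‖A‖ * ∑ b, k c b * (Real.exp (δ' * ρ (posOut c) (posIn b)) * ‖Y‖) := by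
    calc Real.exp (δ' * ϖ (posOut c)) * ‖W A c‖
        ≤ Real.exp (δ' * ϖ (posOut c)) * (‖A‖ * ∑ b, k c b * ‖A b‖) :=
          mul_le_mul_of_nonneg_left (hquad A hAa c) (by positivity)
      _ = ‖A‖ * ∑ b, k c b * (Real.exp (δ' * ϖ (posOut c)) * ‖A b‖) := by
          rw [Finset.mul_sum, Finset.mul_sum, Finset.mul_sum]
          refine Finset.sum_congr rfl fun b _ => ?_; ring
      _ ≤ ‖A‖ * ∑ b, k c b * (Real.exp (δ' * ρ (posOut c) (posIn b)) * ‖Y‖) := by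
          refine mul_le_mul_of_nonneg_left (Finset.sum_le_sum fun b _ =>
            mul_le_mul_of_nonneg_left ?_ (hk c b)) (norm_nonneg _)
          have := pinned_component_le ρ posIn ϖ hδ' hϖ Y (posOut c) b
          simpa [hA, WSup.toPiL_apply] using this
  have h2 : ∑ b, k c b * (Real.exp (δ' * ρ (posOut c) (posIn b)) * ‖Y‖) ≤ M * ‖Y‖ := by
    have : ∑ b, k c b * (Real.exp (δ' * ρ (posOut c) (posIn b)) * ‖Y‖) =
        (∑ b, k c b * Real.exp (δ' * ρ (posOut c) (posIn b))) * ‖Y‖ := by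
      rw [Finset.sum_mul]; refine Finset.sum_congr rfl fun b _ => ?_; ring
    rw [this]
    exact mul_le_mul_of_nonneg_right (hM c) hY0
  calc Real.exp (δ' * ϖ (posOut c)) * ‖W A c‖
      ≤ ‖A‖ * ∑ b, k c b * (Real.exp (δ' * ρ (posOut c) (posIn b)) * ‖Y‖) := h1
    _ ≤ ‖Y‖ * (M * ‖Y‖) := mul_le_mul hflat h2 (Finset.sum_nonneg fun b _ => by
        have := hk c b; positivity) hY0
    _ = M * ‖Y‖ ^ 2 := by ring

end Quad

/-! ## §3 `Prop4Hyp` in the pinned currency -/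

section Prop4

variable {S : Type*}

/-- **PINNED `Prop4Hyp` FROM DISPLAYED FLAT DATA.**  Under the hypotheses of `pinned_quad_le` plus the analyticity of
`W` on the flat ball `{A | ‖A‖ < a₃}` (`a₃ > 0`), the map read between the pinned spaces,
`W_pin := (toPiL pin′).symm ∘ W ∘ toPiL pin`, satisfies `B11Prop6Scheme.Prop4Hyp W_pin M a₃` LITERALLY — S70 f4's `hW`
in the pinned currency.  (The pinned ball is contained in the flat ball; differentiability transfers through S65 f2a's
`WSup.differentiableOn_iff`.) [folklore] -/
theorem prop4Hyp_pinned (W : (Λ → 𝔄) → (Λ' → 𝔅)) (k : Λ' → Λ → ℝ) (ρ : S → S → ℝ) (posIn : Λ → S)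
    (posOut : Λ' → S) (ϖ : S → ℝ) {δ' a₃ M : ℝ} (hδ' : 0 ≤ δ') (hϖ0 : ∀ x, 0 ≤ ϖ x)
    (hϖ : ∀ x y, ϖ x ≤ ϖ y + ρ x y) (hk : ∀ c b, 0 ≤ k c b) (ha₃ : 0 < a₃)
    (hquad : ∀ A : Λ → 𝔄, ‖A‖ < a₃ → ∀ c, ‖W A c‖ ≤ ‖A‖ * ∑ b, k c b * ‖A b‖)
    (hM0 : 0 ≤ M) (hM : ∀ c, ∑ b, k c b * Real.exp (δ' * ρ (posOut c) (posIn b)) ≤ M)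
    (hWd : DifferentiableOn ℂ W {A : Λ → 𝔄 | ‖A‖ < a₃}) :
    Prop4Hyp (fun Y : WSup (pinW δ' (ϖ ∘ posIn)) 1 𝔄 =>
        ((WSup.toPiL (pinW δ' (ϖ ∘ posOut)) 1).symm (W (WSup.toPiL (pinW δ' (ϖ ∘ posIn)) 1 Y)) :
          WSup (pinW δ' (ϖ ∘ posOut)) 1 𝔅)) M a₃ where
  quad Y hY := pinned_quad_le W k ρ posIn posOut ϖ hδ' hϖ0 hϖ hk hquad hM0 hM Y hY
  differentiableOn := by
    rw [WSup.differentiableOn_iff (pinW δ' (ϖ ∘ posIn)) 1 (pinW δ' (ϖ ∘ posOut)) 1 W ha₃]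
    refine hWd.mono fun A hA => ?_
    -- the flat pinned ball `{∀ b, e^{δ′ϖ} ‖A b‖ < a₃}` lies in the flat ball `{‖A‖ < a₃}` (`e^{δ′ϖ} ≥ 1`)
    simp only [mem_setOf_eq] at hA ⊢
    refine (pi_norm_lt_iff ha₃).2 fun b => ?_
    have hb := hA b
    rw [pow_one, pinW_apply, comp_apply] at hb
    have h1 : (1 : ℝ) ≤ Real.exp (δ' * ϖ (posIn b)) := Real.one_le_exp (mul_nonneg hδ' (hϖ0 _))
    calc ‖A b‖ = 1 * ‖A b‖ := (one_mul _).symm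
      _ ≤ Real.exp (δ' * ϖ (posIn b)) * ‖A b‖ := mul_le_mul_of_nonneg_right h1 (norm_nonneg _)
      _ < a₃ := hb

/-- NON-VACUITY (trigger c3): the binder shapes of `prop4Hyp_pinned` are jointly inhabited by the ZERO map with the
zero majorant on a one-point index set (`M = 0`, `a₃ = 1`, pin `ϖ ≡ 0`, `ρ ≡ 0`). [folklore] -/
example : Prop4Hyp (fun Y : WSup (pinW (0 : ℝ) ((fun _ : Unit => (0 : ℝ)) ∘ fun _ : Unit => ())) 1 ℂ =>
    ((WSup.toPiL (pinW (0 : ℝ) ((fun _ : Unit => (0 : ℝ)) ∘ fun _ : Unit => ())) 1).symm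
      ((fun _ : Unit → ℂ => (0 : Unit → ℂ)) (WSup.toPiL (pinW (0 : ℝ) ((fun _ : Unit => (0 : ℝ)) ∘ fun _ : Unit => ()))
        1 Y)) : WSup (pinW (0 : ℝ) ((fun _ : Unit => (0 : ℝ)) ∘ fun _ : Unit => ())) 1 ℂ)) 0 1 :=
  prop4Hyp_pinned (S := Unit) (fun _ => 0) (fun _ _ => 0) (fun _ _ => 0) (fun _ => ()) (fun _ => ()) (fun _ => 0)
    le_rfl (fun _ => le_rfl) (fun _ _ => by simp) (fun _ _ => le_rfl) one_pos
    (fun A _ c => by simp) le_rfl (fun c => by simp) (differentiableOn_const _)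

end Prop4

end Summit.QuantumFields.BalabanUV.T4Continuum.ShellMeasurePinnedProp4

end
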